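import Mathlib
import Summits.Ventures.PercRepro.PuncturedLYMMixT5Q1Table1
import Summits.Ventures.PercRepro.PuncturedLYMMixT5Q1Table2

/-!
# PercRepro — (SP) FOR `5` PAIRWISE DISJOINT TRIPLES AND `1` PAIRWISE DISJOINT QUADRUPLES AT LEVEL `4`: POSITIVITY OF THE DENOMINATORS (1)
(p10, gen 41)

`den > 0`, `Pc > 0` for `n ≥ 19`; `Yc > 0` for `n ≥ 5`.  Nothing here asserts (SP).
-/

namespace PercRepro.PuncturedLYM.Split.TypeLift.MixT5Q1

/-- `den > 0` for `n ≥ 19`. -/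
theorem den_pos (n : ℚ) (hn : 19 ≤ n) : 0 < den n := by
  obtain ⟨n', hn', rfl⟩ : ∃ n', 0 ≤ n' ∧ n = 19 + n' := ⟨n - 19, by linarith, by ring⟩
  have h : den (19 + n') = 31104 * n' ^ 15 + 8115552 * n' ^ 14 + 987709680 * n' ^ 13 + 74376262152 * n' ^ 12 + 3875037665580 * n' ^ 11 + 147953253137472 * n' ^ 10 + 4276352690215572 * n' ^ 9 + 95271253258435944 * n' ^ 8 + 1649374501918717956 * n' ^ 7 + 22187896409506441008 * n' ^ 6 + 230018945572316634204 * n' ^ 5 + 1804527942975005962368 * n' ^ 4 + 10369638654523737617520 * n' ^ 3 + 41203497923186164779840 * n' ^ 2 + 101221603306287514364160 * n' + 115887779690189279984640 := by unfold den; ring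
  rw [h]; positivity

/-- `Yc > 0` for `n ≥ 5`. -/
theorem Yc_pos (n : ℚ) (hn : 5 ≤ n) : 0 < Yc n := by
  obtain ⟨n', hn', rfl⟩ : ∃ n', 0 ≤ n' ∧ n = 5 + n' := ⟨n - 5, by linarith, by ring⟩
  have h : Yc (5 + n') = (1 / 120) * n' ^ 5 + (1 / 8) * n' ^ 4 + (17 / 24) * n' ^ 3 + (15 / 8) * n' ^ 2 + (137 / 60) * n' + 1 := by unfold Yc; ring
  rw [h]; positivity

/-- `Pc > 0` for `n ≥ 19`. -/
theorem Pc_pos (n : ℚ) (hn : 19 ≤ n) : 0 < Pc n := by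
  obtain ⟨n', hn', rfl⟩ : ∃ n', 0 ≤ n' ∧ n = 19 + n' := ⟨n - 19, by linarith, by ring⟩
  have h : Pc (19 + n') = (1 / 24) * n' ^ 4 + (35 / 12) * n' ^ 3 + (1835 / 24) * n' ^ 2 + (10615 / 12) * n' + 3795 := by unfold Pc; ring
  rw [h]; positivity

end PercRepro.PuncturedLYM.Split.TypeLift.MixT5Q1
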